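import Literature.MathematicalPhysics.QuantumLattice.WilsonBlockHeatBathL2
import Literature.MathematicalPhysics.QuantumLattice.TorusWilsonGibbs
import Literature.MathematicalPhysics.QuantumFieldTheory.YangMillsOS
import Mathlib.MeasureTheory.Function.L2Space
import Mathlib.Analysis.Normed.Algebra.Exponential
import Mathlib.Analysis.SpecialFunctions.Exponential
import HarnessLib

/-!
# The overlapping block heat-bath sampler of the torus Wilson theory — conditional expectations

Theorems (no definitions) behind the block-dynamics / finite-speed-of-propagation arguments for the torus Wilson
lattice gauge theory `wilsonMeasure ρ β` (vocabulary: `WilsonBlockHeatBath.lean`; Martinelli 1999 §3):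

* `exists_local_condExp_version` — LOCALITY (Markov property) of `E_μ[· | links off Λ]`: for a bounded observable of
  the links in `Λ ∪ T`, `T` containing the plaquettes touching `Λ`, the DLR kernel of the plaquette potential is a
  bounded `T`-local version (tree `TorusWilsonGibbs`);
* `torusLift_gaugeTransform`, `configShift_gaugeTransformZd`, `shiftedObservable_props` — a (time-shifted) local
  gauge-invariant `ℤ⁴` observable read through the periodic lift is a bounded measurable gauge-invariant local torus
  observable;
* `exp_apply_eq_self_of_apply_eq_zero`, `exp_apply_mem_of_forall_apply_mem` — `exp` of a bounded operator fixes its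
  kernel vectors and leaves closed invariant subspaces invariant (exponential series; the block semigroup
  `P_t = exp(−tH)`, `H = ∑_z (1 − E_z)`);
* `L²` bookkeeping of the heat-bath projection `E_z` = `Submodule.starProjection` of `lpMeas (extSigma z)`: inner
  products with `1` as integrals, constants and locally measurable functions in `lpMeas`, `E_z` is a version of
  `condExp` and preserves the mean, `⟪(1 − E_z) x, x⟫ = ‖x − E_z x‖²`.

(Conditional expectations under gauge transformations, Haar averaging and gauge-invariant versions: tree
`WilsonBlockHeatBathMarkov3`; link σ-algebras: `WilsonBlockHeatBathMarkov`.)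

References: F. Martinelli, *Lectures on Glauber dynamics for discrete spin models*, LNM 1717 (1999), §3 (block
dynamics, finite speed of propagation); S. Friedli, Y. Velenik, *Statistical Mechanics of Lattice Systems* (CUP 2017),
§6.3 (Markov property of finite-range specifications); H.-O. Georgii, *Gibbs Measures and Phase Transitions* (2011),
Def. 1.23.  Deliberately NOT here: the Poincaré sector and the local subspaces (`…Semigroup2`), the index geometry of the
light cone (`…LightCone`, `…LightCone2`).
-/

open scoped BigOperators InnerProductSpace
open _root_.MeasureTheory _root_.Filter _root_.Topology
open Literature.MathematicalPhysics.QuantumFieldTheory Literature.MathematicalPhysics.QuantumLattice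
open Literature.Probability.LatticeModels (gibbsSpecOfPotential isSpecification_gibbsSpecOfPotential
  Torus.proj Torus.proj_apply)

noncomputable section

namespace Literature.MathematicalPhysics.QuantumLattice.WilsonBlockHeatBath

/-! ## Part B: conditional expectations, gauge averaging, locality -/




section Torus


variable {G : Type} [Group G] [TopologicalSpace G] [IsTopologicalGroup G] [CompactSpace G]
  [MeasurableSpace G] [BorelSpace G] {N Nρ : ℕ}




variable (ρ : G →* Matrix (Fin Nρ) (Fin Nρ) ℂ)

/-- **Locality (Markov property) of the heat-bath conditional expectations of the torus Wilson
theory.** [cite: Martinelli1999, §3] -/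
theorem exists_local_condExp_version [T2Space G] [SecondCountableTopology G] [NeZero N]
    (hρ : Continuous ρ) (β : ℝ) (Λ : Finset (Edge 4 N)) {T : Set (Edge 4 N)}
    (hT : ∀ (y : Site 4 N) (i j : Fin 4), i < j →
      (({(y, i), (y.shift i, j), (y.shift j, i), (y, j)} : Finset (Edge 4 N)) ∩ Λ).Nonempty →
      (↑({(y, i), (y.shift i, j), (y.shift j, i), (y, j)} : Finset (Edge 4 N)) : Set (Edge 4 N)) ⊆
        ↑Λ ∪ T)
    {F : GaugeConfig 4 N G → ℝ} (hFm : Measurable F) {C : ℝ} (hC : ∀ U, |F U| ≤ C)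
    (hF : DependsOn F (↑Λ ∪ T)) :
    ∃ F' : GaugeConfig 4 N G → ℝ, Measurable F' ∧ (∀ U, |F' U| ≤ C) ∧ DependsOn F' T ∧
      F' =ᵐ[wilsonMeasure (d := 4) (L := N) ρ β]
        (wilsonMeasure (d := 4) (L := N) ρ β)[F | cylinderEvents (X := fun _ : Edge 4 N => G)
          ((↑Λ : Set (Edge 4 N))ᶜ)] := by
  obtain ⟨Φ, supp, hΦ, hΦb, hsupp, hH, hplaq⟩ := exists_plaquettePotential (d := 4) (L := N) ρ hρ
  have hμ := isGibbsMeasure_wilsonMeasure ρ hρ hΦ hΦb hsupp hH β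
  have hT' : ∀ A ∈ supp Λ, (A ∩ Λ).Nonempty → (↑A : Set (Edge 4 N)) ⊆ ↑Λ ∪ T := by
    intro A hA hne
    obtain ⟨y, i, j, hij, rfl⟩ := hplaq Λ A hA
    exact hT y i j hij hne
  obtain ⟨hsm, hae⟩ := stronglyMeasurable_and_ae_eq_condExp_integral_gibbsSpecOfPotential
    (haarProbability G) hΦ hΦb hsupp β hμ Λ hT' hFm hC hF
  have hγ := isSpecification_gibbsSpecOfPotential (haarProbability G) hΦ hΦb hsupp β
  have hsm' : StronglyMeasurable[linkSigma (G := G) T]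
      (fun η => ∫ σ, F σ ∂(gibbsSpecOfPotential (haarProbability G) Φ supp β Λ η)) := by
    rw [linkSigma_eq_cylinderEvents]; exact hsm
  refine ⟨_, hsm.measurable.mono cylinderEvents_le_pi le_rfl, fun η => ?_,
    dependsOn_of_stronglyMeasurable_linkSigma hsm', hae⟩
  haveI := hγ.isProbability Λ η
  have := norm_integral_le_of_norm_le_const (μ := gibbsSpecOfPotential (haarProbability G) Φ supp β Λ η)
    (f := F) (C := C) (ae_of_all _ fun U => by rw [Real.norm_eq_abs]; exact hC U)
  simpa [Real.norm_eq_abs] using this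

end Torus

/-! ## Part E: lifted observables -/
section Observables


variable {G : Type} [Group G] [MeasurableSpace G] {N : ℕ}

omit [MeasurableSpace G] in
/-- The periodic lift intertwines torus gauge transformations with periodic `ℤ⁴` gauge
transformations. [folklore] -/
theorem torusLift_gaugeTransform (g : Site 4 N → G) (U : GaugeConfig 4 N G) :
    torusLift N (gaugeTransform g U) = gaugeTransformZd (g ∘ Torus.proj N) (torusLift N U) := by
  funext e
  simp only [torusLift, Function.comp_apply, torusEdge, gaugeTransform, gaugeTransformZd]
  congr 2
  · congr 1
    funext k
    simp only [Site.shift, Torus.proj_apply, Pi.add_apply, Int.cast_add, Pi.single_apply]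
    split_ifs <;> simp

/-- Translations intertwine `ℤ⁴` gauge transformations. [folklore] -/
theorem configShift_gaugeTransformZd (v : Literature.Probability.LatticeModels.Site 4)
    (g : Literature.Probability.LatticeModels.Site 4 → G) (U : LGConfig 4 G) :
    configShift v (gaugeTransformZd g U) = gaugeTransformZd (fun y => g (y - v)) (configShift v U) := by
  funext e
  simp only [configShift_apply, gaugeTransformZd, add_sub_right_comm]

/-- A shifted local gauge-invariant observable, read through the periodic lift, is a bounded
measurable gauge-invariant torus observable reading only the projected shifted support. [folklore] -/
theorem shiftedObservable_props (O : YMSpecies G) (v : ℤ) (N : ℕ) :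
    Measurable (fun U : GaugeConfig 4 N G => O.F (configShift (-Pi.single 0 v) (torusLift N U))) ∧
    (∃ C, ∀ U : GaugeConfig 4 N G, |O.F (configShift (-Pi.single 0 v) (torusLift N U))| ≤ C) ∧
    IsGaugeInvariant (fun U : GaugeConfig 4 N G => O.F (configShift (-Pi.single 0 v) (torusLift N U))) ∧
    DependsOn (fun U : GaugeConfig 4 N G => O.F (configShift (-Pi.single 0 v) (torusLift N U)))
      ↑(O.supp.image fun e => torusEdge N (e.1 + Pi.single 0 v, e.2)) := by
  refine ⟨O.measurable.comp ((configShift _).measurable.comp (measurable_torusLift N)),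
    O.bounded.imp fun C hC U => hC _, fun g U => ?_, fun U V h => ?_⟩
  · simp only
    rw [torusLift_gaugeTransform, configShift_gaugeTransformZd]
    exact O.gaugeInvariant _ _
  · refine O.isCylinder fun e he => ?_
    simp only [configShift_apply, torusLift, Function.comp_apply, sub_neg_eq_add]
    exact h _ (Finset.mem_coe.2 (Finset.mem_image_of_mem _ he))


end Observables

/-! ## Part A: operators on Banach and Hilbert spaces -/
section Operators


variable {E : Type} [NormedAddCommGroup E] [NormedSpace ℝ E] [CompleteSpace E]

/-- If `A x = 0` then `exp(A) x = x`. [folklore] -/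
theorem exp_apply_eq_self_of_apply_eq_zero (A : E →L[ℝ] E) {x : E} (hx : A x = 0) :
    NormedSpace.exp A x = x := by
  have hsum : Summable fun n : ℕ => ((n.factorial : ℝ)⁻¹) • A ^ n :=
    NormedSpace.expSeries_summable' A
  have hexp : NormedSpace.exp A = ∑' n : ℕ, ((n.factorial : ℝ)⁻¹) • A ^ n := by
    rw [NormedSpace.exp_eq_tsum ℝ]
  have hpow : ∀ n : ℕ, (A ^ (n + 1)) x = 0 := by
    intro n
    rw [pow_succ, mul_apply_eq_comp, hx, map_zero]
  rw [hexp]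
  rw [← ContinuousLinearMap.apply_apply x, ContinuousLinearMap.map_tsum _ hsum]
  simp only [ContinuousLinearMap.apply_apply, smul_apply]
  rw [tsum_eq_zero_add']
  · simp only [Nat.factorial_zero, Nat.cast_one, inv_one, pow_zero, one_apply_eq_self,
      one_smul, hpow, smul_zero, tsum_zero, add_zero]
  · simp only [hpow, smul_zero]
    exact summable_zero

/-- A closed `A`-invariant subspace is `exp(A)`-invariant. [folklore] -/
theorem exp_apply_mem_of_forall_apply_mem (A : E →L[ℝ] E) (p : Submodule ℝ E)
    (hp : IsClosed (p : Set E)) (hA : ∀ x ∈ p, A x ∈ p) {x : E} (hx : x ∈ p) :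
    NormedSpace.exp A x ∈ p := by
  have hsum : Summable fun n : ℕ => ((n.factorial : ℝ)⁻¹) • A ^ n :=
    NormedSpace.expSeries_summable' A
  have hexp : NormedSpace.exp A = ∑' n : ℕ, ((n.factorial : ℝ)⁻¹) • A ^ n := by
    rw [NormedSpace.exp_eq_tsum ℝ]
  have hpow : ∀ n : ℕ, (A ^ n) x ∈ p := by
    intro n
    induction n with
    | zero => simpa using hx
    | succ n ih => rw [pow_succ', mul_apply_eq_comp]; exact hA _ ih
  rw [hexp, ← ContinuousLinearMap.apply_apply x, ContinuousLinearMap.map_tsum _ hsum]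
  simp only [ContinuousLinearMap.apply_apply, smul_apply]
  exact tsum_mem hp fun n => p.smul_mem _ (hpow n)

end Operators

/-! ## Part D: `L²` bookkeeping -/
section L2


variable {α : Type*} {m m0 : MeasurableSpace α} (μ : Measure α) [IsProbabilityMeasure μ]

omit [IsProbabilityMeasure μ] in
/-- The `L²` inner product of two classes is the integral of the product. [folklore] -/
theorem inner_eq_integral_mul (x y : Lp ℝ 2 μ) : ⟪x, y⟫_ℝ = ∫ a, x a * y a ∂μ := by
  rw [L2.inner_def]
  refine integral_congr_ae (ae_of_all _ fun a => ?_)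
  simp only [RCLike.inner_apply, conj_trivial]
  ring

/-- Inner product with the constant `1` is the integral. [folklore] -/
theorem inner_const_one_left (x : Lp ℝ 2 μ) : ⟪Lp.const 2 μ (1 : ℝ), x⟫_ℝ = ∫ a, x a ∂μ := by
  rw [← indicatorConstLp_univ, L2.inner_indicatorConstLp_one, Measure.restrict_univ]

/-- Scalar multiples of the constant `1` are the constants. [folklore] -/
theorem smul_Lp_const_one (c : ℝ) : c • Lp.const 2 μ (1 : ℝ) = Lp.const 2 μ c := by
  refine Lp.ext ?_
  filter_upwards [Lp.coeFn_smul c (Lp.const 2 μ (1 : ℝ)), Lp.coeFn_const 2 μ (1 : ℝ),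
    Lp.coeFn_const 2 μ c] with U h1 h2 h3
  rw [h1, Pi.smul_apply, h2, h3]; simp

/-- `⟪1, 1⟫ = 1` on a probability space. [folklore] -/
theorem inner_Lp_const_one_one : ⟪Lp.const 2 μ (1 : ℝ), Lp.const 2 μ (1 : ℝ)⟫_ℝ = 1 := by
  rw [inner_const_one_left, integral_congr_ae (Lp.coeFn_const 2 μ (1 : ℝ))]; simp

/-- `‖1‖ = 1` on a probability space. [folklore] -/
theorem norm_Lp_const_one : ‖Lp.const 2 μ (1 : ℝ)‖ = 1 := by
  have h := real_inner_self_eq_norm_sq (Lp.const 2 μ (1 : ℝ))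
  rw [inner_Lp_const_one_one] at h
  nlinarith only [h, norm_nonneg (Lp.const 2 μ (1 : ℝ))]

/-- Bounded functions have small `L²` norm on a probability space. [folklore] -/
theorem norm_le_of_abs_le (x : Lp ℝ 2 μ) {C : ℝ} (hC : 0 ≤ C) (h : ∀ᵐ a ∂μ, |x a| ≤ C) : ‖x‖ ≤ C := by
  have := Lp.norm_le_of_ae_bound (f := x) hC (h.mono fun a ha => by rwa [Real.norm_eq_abs])
  have h1 : measureUnivNNReal μ = 1 := by
    rw [← ENNReal.coe_inj, coe_measureUnivNNReal, measure_univ, ENNReal.coe_one]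
  simpa [h1] using this

omit [IsProbabilityMeasure μ] in
/-- A function measurable for a sub-σ-algebra gives a class in `lpMeas`. [folklore] -/
theorem toLp_mem_lpMeas {f : α → ℝ} (hf : Measurable[m] f) (h2 : MemLp f 2 μ) :
    h2.toLp f ∈ lpMeas ℝ ℝ m 2 μ :=
  mem_lpMeas_iff_aestronglyMeasurable.2 ⟨f, hf.stronglyMeasurable, MemLp.coeFn_toLp h2⟩

/-- Constants are in every `lpMeas`. [folklore] -/
theorem const_mem_lpMeas (c : ℝ) : Lp.const 2 μ c ∈ lpMeas ℝ ℝ m 2 μ :=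
  mem_lpMeas_iff_aestronglyMeasurable.2 ⟨fun _ => c, stronglyMeasurable_const, Lp.coeFn_const 2 μ c⟩

/-- The heat-bath projection fixes constants. [folklore] -/
theorem starProjection_const [hm : Fact (m ≤ m0)] (c : ℝ) :
    (lpMeas ℝ ℝ m 2 μ).starProjection (Lp.const 2 μ c) = Lp.const 2 μ c :=
  Submodule.starProjection_eq_self_iff.2 (const_mem_lpMeas μ c)

/-- The heat-bath projection is a version of the conditional expectation. [folklore] -/
theorem starProjection_ae_eq_condExp [hm : Fact (m ≤ m0)] (x : Lp ℝ 2 μ) :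
    ((lpMeas ℝ ℝ m 2 μ).starProjection x : α → ℝ) =ᵐ[μ] μ[x | m] := by
  have h1 : ((lpMeas ℝ ℝ m 2 μ).starProjection x : Lp ℝ 2 μ) =
      (condExpL2 ℝ ℝ hm.out ((Lp.memLp x).toLp x) : Lp ℝ 2 μ) := by
    rw [Lp.toLp_coeFn]; rfl
  rw [h1]
  exact (Lp.memLp x).condExpL2_ae_eq_condExp hm.out

/-- The heat-bath projection preserves the mean. [folklore] -/
theorem integral_starProjection [hm : Fact (m ≤ m0)] (x : Lp ℝ 2 μ) :
    ∫ a, ((lpMeas ℝ ℝ m 2 μ).starProjection x : α → ℝ) a ∂μ = ∫ a, x a ∂μ := by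
  rw [integral_congr_ae (starProjection_ae_eq_condExp μ x)]
  exact integral_condExp hm.out

/-- `⟪(1 - P) x, x⟫ = ‖x - P x‖²` for an orthogonal projection `P`. [folklore] -/
theorem inner_one_sub_starProjection {F : Type*} [NormedAddCommGroup F] [InnerProductSpace ℝ F]
    (K : Submodule ℝ F) [K.HasOrthogonalProjection] (x : F) :
    ⟪(1 - K.starProjection) x, x⟫_ℝ = ‖x - K.starProjection x‖ ^ 2 := by
  rw [sub_apply, one_apply_eq_self]
  have h0 : ⟪x - K.starProjection x, K.starProjection x⟫_ℝ = 0 :=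
    Submodule.starProjection_inner_eq_zero x _ (Submodule.starProjection_apply_mem K x)
  have : ⟪x - K.starProjection x, x⟫_ℝ = ⟪x - K.starProjection x, x - K.starProjection x⟫_ℝ +
      ⟪x - K.starProjection x, K.starProjection x⟫_ℝ := by
    rw [← inner_add_right, sub_add_cancel]
  rw [this, h0, add_zero, real_inner_self_eq_norm_sq]

/-- `‖x - P x‖² = ∫ (x - E[x|m])²`. [folklore] -/
theorem norm_sub_starProjection_sq [hm : Fact (m ≤ m0)] (x : Lp ℝ 2 μ) :
    ‖x - (lpMeas ℝ ℝ m 2 μ).starProjection x‖ ^ 2 = ∫ a, (x a - (μ[x | m]) a) ^ 2 ∂μ := by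
  refine norm_sq_eq_integral_sq _ ?_
  filter_upwards [Lp.coeFn_sub x ((lpMeas ℝ ℝ m 2 μ).starProjection x),
    starProjection_ae_eq_condExp μ (m := m) x] with a ha hb
  rw [ha, Pi.sub_apply, hb]


end L2

end Literature.MathematicalPhysics.QuantumLattice.WilsonBlockHeatBath

end
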